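import Summits.Ventures.CertifiedArithmetic.LowPrec.SRPythagorasTwoBits
import Summits.Ventures.CertifiedArithmetic.LowPrec.SRPythagorasAllSigns
import HarnessLib

/-!
# Stochastic rounding in low-precision formats CXVI — TWO random bits on NEGATIVE windows and on each
# one-signed half of every format (mirror image of CXV); FP8 / binary16 instances

HONEST FRAMING: certified error envelopes and provably optimal rounding/accumulation schemes for
low-precision formats under stated cost models; every table by two implementations; no hardware or
vendor claims.

CXV (`SRPythagorasTwoBits`) proved that on every ONE-SIGNED nested window `0 ≤ lo` (any depth `J`) IEEE
P3109 StochasticA with `N = 2` random bits obeys the Pythagorean law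
`E(ŝₙ − sₙ)² ≤ n·G²/4 + (n·G/4)²`, `G = 2^J·g`, for every `n` and every unsaturated tree.  StochasticA is
applied sign-magnitude, so by the reflection `c ↦ −c` of XCVI (`accExpQ_neg`, `noSat_neg`,
`inWindow_neg`) the theorem transfers verbatim to NEGATIVE windows `hi ≤ 0` whose mirror image
`[−hi, −lo]` is nested (`NestedWindow.stochasticA_two_mirror`), hence to every nonpositive window of
every `Format` (`valueSet_stochasticA_two_mirror`, `G = 2^{binadeIdx(−lo)}·quantum`) and to the whole
nonpositive range `[−maxRat, 0]` (`valueSet_stochasticA_two_acc_sq_le_nonpos`, `G` = top spacing).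
With CXV's nonnegative half this gives: on EITHER one-signed half of every format two random bits
suffice for the law, with no bit threshold (XCVIII's antitone route asks for `emaxCode − 1` bits:
E4M3 `14`, E5M2 `29`, binary16 `29`).  Kernel-free instances: E3M2 `[−28, −1]` (`4n + n²`), FP8 E4M3 and
binary16 (`256n + 64n²` on each half), FP8 E5M2 (`G = 8192`).
Scope (honest): one-signed windows only — ACROSS ZERO two bits are NOT claimed (XCVIII
`e3m2_two_bits_fail_across_zero`: the antitone route fails there with two bits; whether the law itself
does is not decided here); no saturation; exact expectations over the outcome tree; the open question of
CXV (three or more bits, `3 ≤ N < J`) is untouched.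
Prior art: [ConnollyHighamMary2021, Lemma 4.4, Thm. 4.6]; [ElararEtAl2025, Thm. 3–4]; IEEE P3109
(sign-magnitude stochastic modes); OCP FP8 (E4M3/E5M2), OCP MX v1.0 (E3M2); IEEE 754 binary16.
No Mathlib precedent.
-/

namespace Summit.Ventures.CertifiedArithmetic.LowPrec.SR

open Literature.ComputerArithmetic.ConnollyHighamMary2021
open Finset

variable {K : Type*} [Field K] [LinearOrder K] [IsStrictOrderedRing K] [FloorRing K]

namespace LimitedBits

/-! ### 1. Negative nested windows, two bits -/

section Reflect

variable {F : Finset K}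

/-- **Two random bits on NEGATIVE windows.**  If `F` is symmetric with `0 ∈ F`, `hi ≤ 0` and the
mirror image `[−hi, −lo]` of the window is nested of depth `J` (grid `g`), then every unsaturated
StochasticA accumulation with `N = 2` random bits confined to `[lo, hi]` satisfies
`E(ŝₙ − sₙ)² ≤ n·G²/4 + (n·G/4)²`, `G = 2^J·g`, for every `n`. -/
theorem NestedWindow.stochasticA_two_mirror (hF : ∀ a ∈ F, -a ∈ F) (h0F : (0 : K) ∈ F) {lo hi g : K}
    {J : ℕ} (hW : NestedWindow F (-hi) (-lo) g J) (hhi : hi ≤ 0) (x : ℕ → K) (n : ℕ) (s : K)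
    (hns : NoSat F x n s) (hw : InWindow F lo hi x n s) :
    accExpQ F (probAwayA 2) x n (fun t => (t - (s + ∑ i ∈ range n, x i)) ^ 2) s
      ≤ n * ((2 ^ J * g) ^ 2 / 4) + (n * (1 / 2 ^ 2 * (2 ^ J * g))) ^ 2 := by
  have hns' := noSat_neg hF x n s hns
  have hw' := inWindow_neg hF x n s hns hw
  have key := hW.stochasticA_two_acc_sq_le (by linarith) (fun i => -x i) n (-s) hns' hw'
  rw [accExpQ_neg hF h0F _ x n _ s hns] at key
  have e : (fun t : K => (-t - (-s + ∑ i ∈ range n, -x i)) ^ 2)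
      = fun t => (t - (s + ∑ i ∈ range n, x i)) ^ 2 := by
    funext t; rw [sum_neg_distrib]; ring
  rwa [e] at key

end Reflect

/-! ### 2. Every format: nonpositive windows and the nonpositive half, two bits -/

section Formats

open Literature.ComputerArithmetic.FloatingPoint (Format MiniFloat)
open Literature.ComputerArithmetic.FloatingPoint.MiniFloat (valueSet valueSet_nonempty)

/-- **Two bits, every format, every nonpositive window.**  For values `lo ≤ hi ≤ 0` of `φ`, every
StochasticA accumulation with TWO random bits confined to `[lo, hi]` (no saturation) satisfies, for
every `n`, `E(ŝₙ − sₙ)² ≤ n·G²/4 + (n·G/4)²` with `G = 2^{binadeIdx(−lo)}·quantum` — no bit threshold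
(XCVIII `valueSet_stochasticA_mirror` asked for `N ≥ binadeIdx(−lo) − binadeIdx(−hi)`). -/
theorem valueSet_stochasticA_two_mirror (φ : Format) {lo hi : ℚ} (hlo : lo ∈ valueSet φ)
    (hhi : hi ∈ valueSet φ) (hhi0 : hi ≤ 0) (hle : lo ≤ hi) (x : ℕ → ℚ) (n : ℕ) (s : ℚ)
    (hns : NoSat (valueSet φ) x n s) (hw : InWindow (valueSet φ) lo hi x n s) :
    accExpQ (valueSet φ) (probAwayA 2) x n (fun t => (t - (s + ∑ i ∈ range n, x i)) ^ 2) s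
      ≤ n * ((2 ^ binadeIdx φ (-lo) * φ.quantum) ^ 2 / 4)
        + (n * (1 / 2 ^ 2 * (2 ^ binadeIdx φ (-lo) * φ.quantum))) ^ 2 := by
  have hW := valueSet_nestedWindow φ (valueSet_symm φ hi hhi) (valueSet_symm φ lo hlo) (by linarith)
  have h := hW.stochasticA_two_mirror (valueSet_symm φ)
    (Summit.Ventures.CertifiedArithmetic.zero_mem_valueSet φ) hhi0 x n s hns hw
  have e : (2 : ℚ) ^ (binadeIdx φ (-lo) - binadeIdx φ (-hi)) * (2 ^ binadeIdx φ (-hi) * φ.quantum)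
      = 2 ^ binadeIdx φ (-lo) * φ.quantum := by
    rw [← mul_assoc, ← pow_add, Nat.sub_add_cancel (binadeIdx_mono φ (by linarith))]
  rwa [e] at h

/-- **Two bits, the whole nonpositive half `[−maxRat, 0]`, every format.**  Every StochasticA
accumulation with TWO random bits confined to `[−maxRat, 0]` obeys the law with
`G = 2^{emaxCode−1}·quantum` (the top spacing), for every `n` (the mirror image of CXV
`valueSet_stochasticA_two_acc_sq_le_nonneg`). -/
theorem valueSet_stochasticA_two_acc_sq_le_nonpos (φ : Format) (x : ℕ → ℚ) (n : ℕ) (s : ℚ)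
    (hns : NoSat (valueSet φ) x n s) (hw : InWindow (valueSet φ) (-φ.maxRat) 0 x n s) :
    accExpQ (valueSet φ) (probAwayA 2) x n (fun t => (t - (s + ∑ i ∈ range n, x i)) ^ 2) s
      ≤ n * ((2 ^ (φ.emaxCode - 1) * φ.quantum) ^ 2 / 4)
        + (n * (1 / 2 ^ 2 * (2 ^ (φ.emaxCode - 1) * φ.quantum))) ^ 2 := by
  have hq := φ.quantum_pos
  have h0mem := Summit.Ventures.CertifiedArithmetic.zero_mem_valueSet φ
  have hmem := MiniFloat.maxRat_mem_valueSet φ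
  have htop : binadeIdx φ φ.maxRat ≤ φ.emaxCode - 1 := Format.shift_le _
  have h := valueSet_stochasticA_two_mirror φ (valueSet_symm φ _ hmem) h0mem le_rfl
    (by linarith [maxRat_nonneg φ]) x n s hns hw
  rw [neg_neg] at h
  refine h.trans ?_
  have hG : (2 : ℚ) ^ binadeIdx φ φ.maxRat * φ.quantum ≤ 2 ^ (φ.emaxCode - 1) * φ.quantum :=
    mul_le_mul_of_nonneg_right (pow_le_pow_right₀ (by norm_num) htop) hq.le
  have hG0 : (0 : ℚ) ≤ 2 ^ binadeIdx φ φ.maxRat * φ.quantum := mul_nonneg (by positivity) hq.le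
  gcongr

/-- **Two bits on EITHER one-signed half, every format.**  If an unsaturated StochasticA accumulation
with TWO random bits stays in `[0, maxRat]` or stays in `[−maxRat, 0]`, then for every `n`
`E(ŝₙ − sₙ)² ≤ n·G²/4 + (n·G/4)²` with `G = 2^{emaxCode−1}·quantum`. -/
theorem valueSet_stochasticA_two_oneSigned (φ : Format) (x : ℕ → ℚ) (n : ℕ) (s : ℚ)
    (hns : NoSat (valueSet φ) x n s)
    (hw : InWindow (valueSet φ) 0 φ.maxRat x n s ∨ InWindow (valueSet φ) (-φ.maxRat) 0 x n s) :
    accExpQ (valueSet φ) (probAwayA 2) x n (fun t => (t - (s + ∑ i ∈ range n, x i)) ^ 2) s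
      ≤ n * ((2 ^ (φ.emaxCode - 1) * φ.quantum) ^ 2 / 4)
        + (n * (1 / 2 ^ 2 * (2 ^ (φ.emaxCode - 1) * φ.quantum))) ^ 2 := by
  rcases hw with hw | hw
  · exact valueSet_stochasticA_two_acc_sq_le_nonneg φ x n s hns hw
  · exact valueSet_stochasticA_two_acc_sq_le_nonpos φ x n s hns hw

end Formats

end LimitedBits

/-! ### 3. Instances: E3M2 negative range, FP8 and binary16 halves -/

namespace Formats

open LimitedBits
open Literature.ComputerArithmetic.FloatingPoint (Format)
open Literature.ComputerArithmetic.FloatingPoint.MiniFloat (valueSet)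

/-- **E3M2, the whole NEGATIVE range `[−28, −1]`, two bits** (mirror of CXV `e3m2_positive_twoBits_law`,
`G = 4`): every unsaturated StochasticA accumulation inside it satisfies `E(ŝₙ − sₙ)² ≤ 4n + n²` for
every `n` (XCVIII's antitone route asks for four bits on this window). -/
theorem e3m2_negative_twoBits_law (x : ℕ → ℚ) (n : ℕ) (s : ℚ) (hns : NoSat e3m2 x n s)
    (hw : InWindow e3m2 (-28) (-1) x n s) :
    accExpQ e3m2 (probAwayA 2) x n (fun t => (t - (s + ∑ i ∈ range n, x i)) ^ 2) s ≤ 4 * n + n ^ 2 := by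
  have hlo : (-28 : ℚ) ∈ valueSet Format.E3M2 := by rw [← e3m2_eq_valueSet]; decide +kernel
  have hhi : (-1 : ℚ) ∈ valueSet Format.E3M2 := by rw [← e3m2_eq_valueSet]; decide +kernel
  have h2 : binadeIdx Format.E3M2 28 = 6 := by decide +kernel
  have hq : Format.E3M2.quantum = 1 / 16 := by decide +kernel
  rw [e3m2_eq_valueSet] at hns hw ⊢
  have h := valueSet_stochasticA_two_mirror Format.E3M2 hlo hhi (by norm_num) (by norm_num) x n s hns hw
  rw [neg_neg, h2, hq] at h
  exact h.trans (le_of_eq (by ring))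

/-- **FP8 E4M3 (OCP), either one-signed half (`[0, 448]` or `[−448, 0]`), TWO random bits** (`G = 32`):
`E(ŝₙ − sₙ)² ≤ 256·n + 64·n²` for every unsaturated StochasticA accumulation that keeps one sign, every
`n` (XCVIII: fourteen bits for the antitone route on the whole range). -/
theorem e4m3_oneSigned_twoBits_law (x : ℕ → ℚ) (n : ℕ) (s : ℚ)
    (hns : NoSat (valueSet Format.E4M3) x n s)
    (hw : InWindow (valueSet Format.E4M3) 0 Format.E4M3.maxRat x n s ∨
      InWindow (valueSet Format.E4M3) (-Format.E4M3.maxRat) 0 x n s) :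
    accExpQ (valueSet Format.E4M3) (probAwayA 2) x n (fun t => (t - (s + ∑ i ∈ range n, x i)) ^ 2) s
      ≤ 256 * n + 64 * n ^ 2 := by
  have hq : Format.E4M3.quantum = 1 / 512 := by decide +kernel
  have he : Format.E4M3.emaxCode - 1 = 14 := by decide
  have h := valueSet_stochasticA_two_oneSigned Format.E4M3 x n s hns hw
  rw [he, hq] at h
  exact h.trans (le_of_eq (by ring))

/-- **FP8 E5M2 (OCP), either one-signed half (`|t| ≤ 57344`), TWO random bits** (`G = 8192`):
`E(ŝₙ − sₙ)² ≤ n·8192²/4 + (2048·n)²` for every `n` (XCVIII: twenty-nine bits on the whole range). -/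
theorem e5m2_oneSigned_twoBits_law (x : ℕ → ℚ) (n : ℕ) (s : ℚ)
    (hns : NoSat (valueSet Format.E5M2) x n s)
    (hw : InWindow (valueSet Format.E5M2) 0 Format.E5M2.maxRat x n s ∨
      InWindow (valueSet Format.E5M2) (-Format.E5M2.maxRat) 0 x n s) :
    accExpQ (valueSet Format.E5M2) (probAwayA 2) x n (fun t => (t - (s + ∑ i ∈ range n, x i)) ^ 2) s
      ≤ n * ((8192 : ℚ) ^ 2 / 4) + (2048 * n) ^ 2 := by
  have hq : Format.E5M2.quantum = 1 / 65536 := by decide +kernel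
  have he : Format.E5M2.emaxCode - 1 = 29 := by decide
  have h := valueSet_stochasticA_two_oneSigned Format.E5M2 x n s hns hw
  rw [he, hq] at h
  exact h.trans (le_of_eq (by ring))

/-- **binary16, either one-signed half (`|t| ≤ 65504`), TWO random bits** (`G = 32`):
`E(ŝₙ − sₙ)² ≤ 256·n + 64·n²` for every `n` (XCVIII: twenty-nine bits on the whole range). -/
theorem binary16_oneSigned_twoBits_law (x : ℕ → ℚ) (n : ℕ) (s : ℚ)
    (hns : NoSat (valueSet Format.Binary16) x n s)
    (hw : InWindow (valueSet Format.Binary16) 0 Format.Binary16.maxRat x n s ∨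
      InWindow (valueSet Format.Binary16) (-Format.Binary16.maxRat) 0 x n s) :
    accExpQ (valueSet Format.Binary16) (probAwayA 2) x n
        (fun t => (t - (s + ∑ i ∈ range n, x i)) ^ 2) s ≤ 256 * n + 64 * n ^ 2 := by
  have hq : Format.Binary16.quantum = 1 / 16777216 := by decide +kernel
  have he : Format.Binary16.emaxCode - 1 = 29 := by decide
  have h := valueSet_stochasticA_two_oneSigned Format.Binary16 x n s hns hw
  rw [he, hq] at h
  exact h.trans (le_of_eq (by ring))

end Formats

end Summit.Ventures.CertifiedArithmetic.LowPrec.SR
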